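import Literature.Analysis.FluidPDE.NSRobustnessOfRegularityAgmonParamH2Flux
import HarnessLib

/-!
# Robustness of regularity on `ℝ³`, `AgmonBoundR3` RE-THREAD IV: the `H²` robustness theorem in strain form, the
# sup-norm readouts and the window form, with the Agmon constant as a PARAMETER

Analysis/FluidPDE proof file (theorems only; no definitions, no named facts, no `sorry`); fourth file of the
re-thread of the vein over `(hAg : AgmonBoundR3 A)`. VERBATIM copies of `classicalNS_robustness_H2_strain_R3`,
`norm_le_agmonConst_mul_rpow_of_le`, `classicalNS_norm_sub_le_of_H1_H2_R3`, `classicalNS_robustness_H2_strain_window_R3`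
(Dashti–Robinson 2008 Thm 2 strain form; Agmon = RRS 2016 Thm 1.20; `NSRobustnessOfRegularityH2`) with
`agmonConst ↦ A`: rate `l = 6G + 9κσ₂ + 3κ²σ₃ + 3A²X₁/(νμ) + 27A⁴X₁²/(16ν³)`, `β = A²μ/ν`, readout
`‖w(x)‖ ≤ A(3X₁Z)^{1/4}`; the slice bound is `robustness_flux_H2_le_strain_of_agmonBound`; the Riccati comparison
is the vein's public machinery (`IsClassicalNSSolutionOn.hessian_sub_balance_forces`, `ForcedPowerComparison`).
Private bookkeeping lemmas are copied verbatim.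

* `classicalNS_robustness_H2_strain_of_agmonBound`, `norm_le_mul_rpow_of_le_of_agmonBound`,
  `classicalNS_norm_sub_le_of_H1_H2_of_agmonBound`, `classicalNS_robustness_H2_strain_window_of_agmonBound`.

WHAT THIS IS NOT: not a statement about Navier–Stokes regularity or blow-up — a-priori calculus between two GIVEN
classical solutions. Consumer: the sup-norm doors and the smoothing files of the re-thread, then the numeral
certificate letters of crux 20303 (`EpisodeBaseT`), cell `ns-blowup`.

## References

* M. Dashti, J. C. Robinson, SIAM J. Numer. Anal. 46 (2008) 3136–3150, Thm 2 (proof), Lemma 1. [DashtiRobinson2008]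
* J. C. Robinson, J. L. Rodrigo, W. Sadowski, *The Three-Dimensional Navier–Stokes Equations*, CUP 2016,
  Thm 1.20, Thm 9.1. [RobinsonRodrigoSadowskiCUP2016]
-/

noncomputable section

open MeasureTheory Set Function Filter Topology InnerProductSpace
open scoped ENNReal NNReal ContDiff RealInnerProductSpace Laplacian

namespace Literature.Analysis.FluidPDE

/-! ## §A Bookkeeping (private copies of the vein's lemmas) -/

/-- `2Ls ≤ κ s² + L²/κ` for `κ > 0`. [folklore] -/
private theorem agq_two_mul_le_kappa {L s κ : ℝ} (hκ : 0 < κ) : 2 * L * s ≤ κ * s ^ 2 + L ^ 2 / κ := by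
  have h : 2 * L * s - κ * s ^ 2 ≤ L ^ 2 / κ := by
    rw [le_div_iff₀ hκ]
    nlinarith [sq_nonneg (κ * s - L)]
  linarith

/-- `∫⁻‖a − b‖² < ∞` from `∫⁻‖a‖², ∫⁻‖b‖² < ∞`. [folklore] -/
private theorem agq_lintegral_sq_sub_lt_top {G : Type*} [NormedAddCommGroup G]
    {a b : EuclideanSpace ℝ (Fin 3) → G}
    (ham : AEStronglyMeasurable a volume) (ha : ∫⁻ x, ‖a x‖ₑ ^ 2 < ⊤)
    (hb : ∫⁻ x, ‖b x‖ₑ ^ 2 < ⊤) : ∫⁻ x, ‖a x - b x‖ₑ ^ 2 < ⊤ :=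
  lt_of_le_of_lt (lintegral_enorm_sq_sub_le (g := b) ham (μ := volume))
    (ENNReal.add_lt_top.2 ⟨ENNReal.mul_lt_top (by simp) ha, ENNReal.mul_lt_top (by simp) hb⟩)

/-- Uniform `L²`-Sobolev bounds pass to slicewise differences: if `c(t) = a(t) − b(t)` on `S` with
smooth slices and `a, b` have all `L²` Sobolev norms bounded on `S`, so does `c`. [folklore] -/
private theorem agq_sobolev_sub {F : Type*} [NormedAddCommGroup F] [NormedSpace ℝ F]
    {S : Set ℝ} {a b c : ℝ → EuclideanSpace ℝ (Fin 3) → F}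
    (habc : ∀ t ∈ S, ∀ x, c t x = a t x - b t x) (ha : ∀ t ∈ S, ContDiff ℝ ∞ (a t))
    (hb : ∀ t ∈ S, ContDiff ℝ ∞ (b t))
    (hA : ∀ n : ℕ, ∃ C : ℝ≥0, ∀ t ∈ S, ∫⁻ x, ‖iteratedFDeriv ℝ n (a t) x‖ₑ ^ 2 ≤ C)
    (hB : ∀ n : ℕ, ∃ C : ℝ≥0, ∀ t ∈ S, ∫⁻ x, ‖iteratedFDeriv ℝ n (b t) x‖ₑ ^ 2 ≤ C) (n : ℕ) :
    ∃ C : ℝ≥0, ∀ t ∈ S, ∫⁻ x, ‖iteratedFDeriv ℝ n (c t) x‖ₑ ^ 2 ≤ C := by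
  obtain ⟨Ca, hCa⟩ := hA n
  obtain ⟨Cb, hCb⟩ := hB n
  refine ⟨2 * Ca + 2 * Cb, fun t ht => ?_⟩
  have hc : c t = a t - b t := funext fun x => by rw [Pi.sub_apply, habc t ht x]
  have hsub : ∀ x, iteratedFDeriv ℝ n (c t) x = iteratedFDeriv ℝ n (a t) x - iteratedFDeriv ℝ n (b t) x :=
    fun x => by
      rw [hc]
      exact iteratedFDeriv_sub_apply ((ha t ht).of_le (by exact_mod_cast le_top)).contDiffAt
        ((hb t ht).of_le (by exact_mod_cast le_top)).contDiffAt
  have hm : AEStronglyMeasurable (fun x => iteratedFDeriv ℝ n (a t) x) volume :=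
    ((ha t ht).continuous_iteratedFDeriv (by exact_mod_cast le_top)).aestronglyMeasurable
  calc ∫⁻ x, ‖iteratedFDeriv ℝ n (c t) x‖ₑ ^ 2
      = ∫⁻ x, ‖iteratedFDeriv ℝ n (a t) x - iteratedFDeriv ℝ n (b t) x‖ₑ ^ 2 :=
        lintegral_congr fun x => by rw [hsub]
    _ ≤ 2 * (∫⁻ x, ‖iteratedFDeriv ℝ n (a t) x‖ₑ ^ 2) + 2 * ∫⁻ x, ‖iteratedFDeriv ℝ n (b t) x‖ₑ ^ 2 :=
        lintegral_enorm_sq_sub_le hm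
    _ ≤ 2 * (Ca : ℝ≥0∞) + 2 * (Cb : ℝ≥0∞) := by
        gcongr
        · exact hCa t ht
        · exact hCb t ht
    _ = ((2 * Ca + 2 * Cb : ℝ≥0) : ℝ≥0∞) := by push_cast; rfl

/-- Order-zero Sobolev bound, unfolded: `∫⁻‖g‖² < ∞`. [folklore] -/
private theorem agq_l2_of_order_zero {F : Type*} [NormedAddCommGroup F] [NormedSpace ℝ F]
    {g : EuclideanSpace ℝ (Fin 3) → F} {C : ℝ≥0} (h : ∫⁻ x, ‖iteratedFDeriv ℝ 0 g x‖ₑ ^ 2 ≤ C) :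
    ∫⁻ x, ‖g x‖ₑ ^ 2 < ⊤ := by
  refine lt_of_le_of_lt ((le_of_eq (lintegral_congr fun x => ?_)).trans h) ENNReal.coe_lt_top
  rw [← ofReal_norm, ← ofReal_norm, norm_iteratedFDeriv_zero]

/-- Uniform-in-time Sobolev bound, at one time: `∫⁻‖Dⁿ(c t)‖² < ∞`. [folklore] -/
private theorem agq_fin {F : Type*} [NormedAddCommGroup F] [NormedSpace ℝ F] {S : Set ℝ}
    {c : ℝ → EuclideanSpace ℝ (Fin 3) → F} {t : ℝ} (ht : t ∈ S) (n : ℕ)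
    (hC : ∃ C : ℝ≥0, ∀ s ∈ S, ∫⁻ x, ‖iteratedFDeriv ℝ n (c s) x‖ₑ ^ 2 ≤ C) :
    ∫⁻ x, ‖iteratedFDeriv ℝ n (c t) x‖ₑ ^ 2 < ⊤ := by
  obtain ⟨C, hC⟩ := hC
  exact lt_of_le_of_lt (hC t ht) ENNReal.coe_lt_top

/-- `∫‖Δw‖² ≤ 3 Σᵢ ∫|∇(∂ᵢw)|²_F` (pointwise `Δw = Σᵢ ∂ᵢ(∂ᵢw)` and Cauchy–Schwarz). [folklore] -/
private theorem agq_integral_laplacian_sq_le_three_mul_sum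
    {w : EuclideanSpace ℝ (Fin 3) → EuclideanSpace ℝ (Fin 3)} (hw : ContDiff ℝ ∞ w)
    (hX : ∀ i, Integrable (fun x => frobeniusNormSq
      (fderiv ℝ (fun y => fderiv ℝ w y (EuclideanSpace.basisFun (Fin 3) ℝ i)) x)) volume) :
    ∫ x, ‖(Δ w) x‖ ^ 2 ≤
      3 * ∑ i, ∫ x, frobeniusNormSq
        (fderiv ℝ (fun y => fderiv ℝ w y (EuclideanSpace.basisFun (Fin 3) ℝ i)) x) := by
  set e := EuclideanSpace.basisFun (Fin 3) ℝ with he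
  have hw2 : ContDiff ℝ 2 w := hw.of_le (by norm_cast)
  -- `(a + b + c)² ≤ 3(a² + b² + c²)`
  have h3 : ∀ a b c : ℝ, (a + b + c) ^ 2 ≤ 3 * (a ^ 2 + b ^ 2 + c ^ 2) := fun a b c => by
    nlinarith [sq_nonneg (a - b), sq_nonneg (b - c), sq_nonneg (a - c)]
  -- pointwise bound
  have hpt : ∀ x, ‖(Δ w) x‖ ^ 2 ≤
      3 * ∑ i, frobeniusNormSq (fderiv ℝ (fun y => fderiv ℝ w y (e i)) x) := by
    intro x
    have hd : DifferentiableAt ℝ (fderiv ℝ w) x :=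
      ((hw2.fderiv_right (m := 1) le_rfl).differentiable one_ne_zero) x
    have hΔ : (Δ w) x = ∑ i, fderiv ℝ (fun y => fderiv ℝ w y (e i)) x (e i) := by
      rw [laplacian_eq_iteratedFDeriv_orthonormalBasis w e]
      refine Finset.sum_congr rfl fun i _ => ?_
      rw [iteratedFDeriv_two_apply, FluidPDE.fderiv_apply_const_apply hd (e i) (e i)]
      rfl
    have hi : ∀ i, ‖fderiv ℝ (fun y => fderiv ℝ w y (e i)) x (e i)‖ ^ 2 ≤
        frobeniusNormSq (fderiv ℝ (fun y => fderiv ℝ w y (e i)) x) := fun i => by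
      rw [frobeniusNormSq_eq_sum e]
      exact Finset.single_le_sum
        (f := fun k => ‖fderiv ℝ (fun y => fderiv ℝ w y (e i)) x (e k)‖ ^ 2)
        (fun k _ => sq_nonneg _) (Finset.mem_univ i)
    rw [hΔ]
    have hns := norm_sum_le (Finset.univ : Finset (Fin 3))
      (fun i => fderiv ℝ (fun y => fderiv ℝ w y (e i)) x (e i))
    generalize hq : (fun i => fderiv ℝ (fun y => fderiv ℝ w y (e i)) x) = q at *
    have hq' : ∀ i, fderiv ℝ (fun y => fderiv ℝ w y (e i)) x = q i := fun i => by rw [← hq]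
    simp only [hq'] at hns hi ⊢
    rw [Fin.sum_univ_three, Fin.sum_univ_three] at hns
    rw [Fin.sum_univ_three, Fin.sum_univ_three]
    have h0 := norm_nonneg (q 0 (e 0) + q 1 (e 1) + q 2 (e 2))
    calc ‖q 0 (e 0) + q 1 (e 1) + q 2 (e 2)‖ ^ 2
        ≤ (‖q 0 (e 0)‖ + ‖q 1 (e 1)‖ + ‖q 2 (e 2)‖) ^ 2 := pow_le_pow_left₀ h0 hns 2
      _ ≤ 3 * (‖q 0 (e 0)‖ ^ 2 + ‖q 1 (e 1)‖ ^ 2 + ‖q 2 (e 2)‖ ^ 2) := h3 _ _ _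
      _ ≤ 3 * (frobeniusNormSq (q 0) + frobeniusNormSq (q 1) + frobeniusNormSq (q 2)) := by
          linarith [hi 0, hi 1, hi 2]
  have iS : Integrable (fun x => ∑ i, frobeniusNormSq (fderiv ℝ (fun y => fderiv ℝ w y (e i)) x))
      volume := integrable_finsetSum _ fun i _ => hX i
  have hR : (∫ x, 3 * ∑ i, frobeniusNormSq (fderiv ℝ (fun y => fderiv ℝ w y (e i)) x)) =
      3 * ∑ i, ∫ x, frobeniusNormSq (fderiv ℝ (fun y => fderiv ℝ w y (e i)) x) := by
    rw [integral_const_mul, integral_finsetSum _ fun i _ => hX i]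
  by_cases hint : Integrable (fun x => ‖(Δ w) x‖ ^ 2) volume
  · rw [← hR]
    exact integral_mono hint (iS.const_mul 3) fun x => hpt x
  · rw [integral_undef hint]
    exact mul_nonneg (by norm_num) (Finset.sum_nonneg fun i _ =>
      integral_nonneg fun x => frobeniusNormSq_nonneg _)


/-- `∫|∇z|²_F < ∞` for a `C¹` field with `Dz ∈ L²` (`|·|²_F ≤ 3‖·‖²` on `ℝ³`). [folklore] -/
private theorem agq_integrable_frobeniusNormSq
    {z : EuclideanSpace ℝ (Fin 3) → EuclideanSpace ℝ (Fin 3)} (hz : ContDiff ℝ 1 z)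
    (hz1 : ∫⁻ x, ‖iteratedFDeriv ℝ 1 z x‖ₑ ^ 2 < ⊤) :
    Integrable (fun x => frobeniusNormSq (fderiv ℝ z x)) volume := by
  refine integrable_of_continuous_of_nonneg
    (FluidPDE.continuous_frobeniusNormSq_fderiv hz one_ne_zero) (fun x => frobeniusNormSq_nonneg _) ?_
  calc ∫⁻ x, ENNReal.ofReal (frobeniusNormSq (fderiv ℝ z x))
      ≤ ∫⁻ x, 3 * ‖iteratedFDeriv ℝ 1 z x‖ₑ ^ 2 :=
        lintegral_mono fun x => by
          rw [← ofReal_norm, norm_iteratedFDeriv_one, ofReal_norm]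
          exact ofReal_frobeniusNormSq_le_three_mul_enorm_sq _
    _ = 3 * ∫⁻ x, ‖iteratedFDeriv ℝ 1 z x‖ₑ ^ 2 := lintegral_const_mul' _ _ (by norm_num)
    _ < ⊤ := ENNReal.mul_lt_top (by norm_num) hz1

/-- A bound `G` of the compression rate of a divergence-free field on `ℝ³` is nonnegative (the
trace `Σᵢ⟪Du eᵢ, eᵢ⟫ = div u` vanishes). [folklore] -/
private theorem agq_compressionRate_nonneg
    {u₀ : EuclideanSpace ℝ (Fin 3) → EuclideanSpace ℝ (Fin 3)} (hdiv : VectorCalculus.IsDivFree u₀)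
    {G : ℝ} (hG : ∀ (x ξ : EuclideanSpace ℝ (Fin 3)), -⟪fderiv ℝ u₀ x ξ, ξ⟫ ≤ G * ‖ξ‖ ^ 2) :
    0 ≤ G := by
  have hd := hdiv 0
  rw [divergence_eq_sum_inner_fderiv (EuclideanSpace.basisFun (Fin 3) ℝ), Fin.sum_univ_three] at hd
  have he : ∀ i, ‖EuclideanSpace.basisFun (Fin 3) ℝ i‖ = 1 := fun i => by simp
  have h0 := hG 0 (EuclideanSpace.basisFun (Fin 3) ℝ 0)
  have h1 := hG 0 (EuclideanSpace.basisFun (Fin 3) ℝ 1)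
  have h2 := hG 0 (EuclideanSpace.basisFun (Fin 3) ℝ 2)
  rw [he, one_pow, mul_one, real_inner_comm] at h0 h1 h2
  linarith


/-- Slicewise Sobolev bounds translate in time. [folklore] -/
private theorem agq_bounds_comp_add {G' : Type*} [NormedAddCommGroup G'] [NormedSpace ℝ G']
    {w : ℝ → EuclideanSpace ℝ (Fin 3) → G'} {a b s : ℝ}
    (h : ∀ n : ℕ, ∃ C : ℝ≥0, ∀ t ∈ Icc (a + s) (b + s), ∫⁻ x, ‖iteratedFDeriv ℝ n (w t) x‖ₑ ^ 2 ≤ C) :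
    ∀ n : ℕ, ∃ C : ℝ≥0, ∀ t ∈ Icc a b, ∫⁻ x, ‖iteratedFDeriv ℝ n (w (t + s)) x‖ₑ ^ 2 ≤ C :=
  fun n => (h n).imp fun _ hC t ht => hC (t + s) ⟨by linarith [ht.1], by linarith [ht.2]⟩

/-- FTC within `[0, T]`: for `φ` continuous on `[0, T]`, `r ↦ ∫₀ʳ φ` has the one-sided
derivative `φ(t)` within `[0, T]` at every `t ∈ [0, T]`. [folklore] -/
private theorem agq_hasDerivWithinAt_intervalIntegral {φ : ℝ → ℝ} {T t : ℝ}
    (hφ : ContinuousOn φ (Icc 0 T)) (ht : t ∈ Icc 0 T) :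
    HasDerivWithinAt (fun r => ∫ x in (0 : ℝ)..r, φ x) (φ t) (Icc 0 T) t := by
  haveI : Fact (t ∈ Icc 0 T) := ⟨ht⟩
  have hint : IntervalIntegrable φ volume 0 t :=
    (hφ.mono (Icc_subset_Icc_right ht.2)).intervalIntegrable_of_Icc ht.1
  exact intervalIntegral.integral_hasDerivWithinAt_right hint
    (hφ.stronglyMeasurableAtFilter_nhdsWithin measurableSet_Icc t) (hφ t ht)

section RobustnessH2

variable {ν T : ℝ} {f g u v : ℝ → EuclideanSpace ℝ (Fin 3) → EuclideanSpace ℝ (Fin 3)}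
variable {p q : ℝ → EuclideanSpace ℝ (Fin 3) → ℝ}

/-- **Robustness of regularity on `ℝ³` at the `H²` level in STRAIN form, a priori (Dashti–Robinson
2008, Thm 2, the a-priori estimate of its proof, with the reference's `H³` rate replaced by the
strain currency `(G, σ₂, σ₃)`).** Let `(u, p)` (force `f`) and `(v, q)` (force `g`) be classical
solutions on `[0, T] × ℝ³` in the `L²`-Sobolev class, the forces with square-integrable first
derivatives, `wᵢ = ∂ᵢ(v − u)`, `Z(t) = Σᵢ∫|∇wᵢ(t)|²_F` (`= ∫|D²(v − u)(t)|²_F`). Let continuous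
majorants on `[0, T]` be given: `−⟪Du(s,x)ξ, ξ⟫ ≤ G(s)‖ξ‖²`, `‖D²u(s,x)‖ ≤ σ₂(s)`,
`‖D³u(s,x)‖ ≤ σ₃(s)`, `‖(v − u)(s)‖_{L²} ≤ L(s)`, `∫|∇(v − u)(s)|²_F ≤ X₁(s)` (the `L²` and `H¹`
levels, e.g. from `classicalNS_robustness_strain_R3`), `∫‖D(f − g)(s)‖² ≤ H₁(s)`; free lengths
`κ, μ > 0`; rate `l = 6G + 9κσ₂ + 3κ²σ₃ + 3A²X₁/(νμ) + 27A⁴X₁²/(16ν³)` (`A` any constant with `AgmonBoundR3 A`),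
`β = A²μ/ν`, source `ψ = 27σ₂X₁/κ + 9σ₃L²/κ² + 6H₁/ν`, envelopes `Λ' = l`, `Λ(0) = 0`,
`Φ' = φ ≥ e^{−Λ}ψ`, `Φ(0) = 0`, `η = Z(0) + Φ(T)`. If `βe^{Λ(T)}ηT < 1` then
`Z(t) ≤ e^{Λ(t)}η/(1 − βe^{Λ(T)}ηt)` on `[0, T]` (the Riccati comparison, Dashti–Robinson's
Lemma 1 with `n = 1`, after `2A²√(X₁·∫‖Δw‖²)Z/ν ≤ 2A²√(3X₁Z)Z/ν ≤ (A²μ/ν)Z² + (3A²X₁/(νμ))Z`).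
[cite: DashtiRobinson2008, Thm 2 (proof) and Lemma 1] -/
theorem classicalNS_robustness_H2_strain_of_agmonBound {A : ℝ} (hAg : AgmonBoundR3 A) (hν : 0 < ν) (hT : 0 < T)
    (hv : IsClassicalNSSolutionOn (Icc 0 T) ν g v q) (hu : IsClassicalNSSolutionOn (Icc 0 T) ν f u p)
    (hU : HasBoundedSobolevNormsOn (Icc 0 T) u)
    (hUt : HasBoundedSobolevNormsOn (Icc 0 T) (timeDerivWithin (Icc 0 T) u))
    (hp : ∀ n : ℕ, ∃ C : ℝ≥0, ∀ t ∈ Icc 0 T, ∫⁻ x, ‖iteratedFDeriv ℝ n (p t) x‖ₑ ^ 2 ≤ C)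
    (hV : HasBoundedSobolevNormsOn (Icc 0 T) v)
    (hVt : HasBoundedSobolevNormsOn (Icc 0 T) (timeDerivWithin (Icc 0 T) v))
    (hq : ∀ n : ℕ, ∃ C : ℝ≥0, ∀ t ∈ Icc 0 T, ∫⁻ x, ‖iteratedFDeriv ℝ n (q t) x‖ₑ ^ 2 ≤ C)
    (hfD : ∀ t ∈ Icc 0 T, ∫⁻ x, ‖fderiv ℝ (f t) x‖ₑ ^ 2 < ⊤)
    (hgD : ∀ t ∈ Icc 0 T, ∫⁻ x, ‖fderiv ℝ (g t) x‖ₑ ^ 2 < ⊤)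
    {G σ₂ σ₃ L X₁ H₁ Λ Φ φ : ℝ → ℝ} {κ μ : ℝ} (hκ : 0 < κ) (hμ : 0 < μ)
    (hG : ∀ s ∈ Icc 0 T, ∀ (x ξ : EuclideanSpace ℝ (Fin 3)), -⟪fderiv ℝ (u s) x ξ, ξ⟫ ≤ G s * ‖ξ‖ ^ 2)
    (hσ₂ : ∀ s ∈ Icc 0 T, ∀ x, ‖iteratedFDeriv ℝ 2 (u s) x‖ ≤ σ₂ s)
    (hσ₃ : ∀ s ∈ Icc 0 T, ∀ x, ‖iteratedFDeriv ℝ 3 (u s) x‖ ≤ σ₃ s)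
    (hL : ∀ s ∈ Icc 0 T, Real.sqrt (∫ x, ‖(v - u) s x‖ ^ 2) ≤ L s)
    (hX₁ : ∀ s ∈ Icc 0 T, ∫ x, frobeniusNormSq (fderiv ℝ ((v - u) s) x) ≤ X₁ s)
    (hH₁ : ∀ s ∈ Icc 0 T, ∫ x, ‖fderiv ℝ (fun y => f s y - g s y) x‖ ^ 2 ≤ H₁ s)
    (hGc : ContinuousOn G (Icc 0 T)) (hσ₂c : ContinuousOn σ₂ (Icc 0 T))
    (hσ₃c : ContinuousOn σ₃ (Icc 0 T)) (hLc : ContinuousOn L (Icc 0 T))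
    (hX₁c : ContinuousOn X₁ (Icc 0 T)) (hH₁c : ContinuousOn H₁ (Icc 0 T))
    (hΛ : ∀ s ∈ Icc 0 T, HasDerivWithinAt Λ (6 * G s + 9 * κ * σ₂ s + 3 * κ ^ 2 * σ₃ s +
      3 * A ^ 2 * X₁ s / (ν * μ) + 27 * A ^ 4 * X₁ s ^ 2 / (16 * ν ^ 3)) (Icc 0 T) s)
    (hΛ0 : Λ 0 = 0)
    (hΦ : ∀ s ∈ Icc 0 T, HasDerivWithinAt Φ (φ s) (Icc 0 T) s) (hΦ0 : Φ 0 = 0)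
    (hφ : ∀ s ∈ Icc 0 T, Real.exp (-Λ s) *
      (27 * σ₂ s / κ * X₁ s + 9 * σ₃ s / κ ^ 2 * L s ^ 2 + 6 / ν * H₁ s) ≤ φ s)
    (hsmall : A ^ 2 * μ / ν * Real.exp (Λ T) *
      ((∑ i, ∫ x, frobeniusNormSq (fderiv ℝ (fun y => fderiv ℝ ((v - u) 0) y
        (EuclideanSpace.basisFun (Fin 3) ℝ i)) x)) + Φ T) * T < 1)
    {t : ℝ} (ht : t ∈ Icc 0 T) :
    (∑ i, ∫ x, frobeniusNormSq (fderiv ℝ (fun y => fderiv ℝ ((v - u) t) y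
        (EuclideanSpace.basisFun (Fin 3) ℝ i)) x)) ≤
      Real.exp (Λ t) * ((∑ i, ∫ x, frobeniusNormSq (fderiv ℝ (fun y => fderiv ℝ ((v - u) 0) y
          (EuclideanSpace.basisFun (Fin 3) ℝ i)) x)) + Φ T) /
        (1 - A ^ 2 * μ / ν * Real.exp (Λ T) *
          ((∑ i, ∫ x, frobeniusNormSq (fderiv ℝ (fun y => fderiv ℝ ((v - u) 0) y
            (EuclideanSpace.basisFun (Fin 3) ℝ i)) x)) + Φ T) * t) := by
  have hU' : UniqueDiffOn ℝ (Icc 0 T) := uniqueDiffOn_Icc hT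
  set e := EuclideanSpace.basisFun (Fin 3) ℝ with he
  have hA : 0 ≤ A := hAg.nonneg
  -- the balance and the two functions `Z`, `F`
  obtain ⟨hFi, hZc, hbal⟩ := hv.hessian_sub_balance_forces hT hu hU hUt hp hV hVt hq hfD hgD
  obtain ⟨Z, hZ⟩ : ∃ Z : ℝ → ℝ, Z = fun t => ∑ i, ∫ x, frobeniusNormSq
      (fderiv ℝ (fun y => fderiv ℝ ((v - u) t) y (e i)) x) := ⟨_, rfl⟩
  obtain ⟨F, hF⟩ : ∃ F : ℝ → ℝ, F = fun t => ∑ i,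
      (-(2 * ν * ∫ x, ‖(Δ (fun y => fderiv ℝ ((v - u) t) y (e i))) x‖ ^ 2) +
        2 * (∫ x, ⟪fderiv ℝ (fun y => convect (v t) ((v - u) t) y + convect ((v - u) t) (u t) y) x
            (e i), (Δ (fun y => fderiv ℝ ((v - u) t) y (e i))) x⟫) +
        2 * (∫ x, ⟪fderiv ℝ (fun y => f t y - g t y) x (e i),
          (Δ (fun y => fderiv ℝ ((v - u) t) y (e i))) x⟫)) := ⟨_, rfl⟩
  have hZc' : ContinuousOn Z (Icc 0 T) := by rw [hZ]; exact hZc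
  have hFi' : IntegrableOn F (Icc 0 T) := by rw [hF]; exact hFi
  have hbal' : ∀ b ∈ Ioc 0 T, Z b = Z 0 + ∫ s in (0 : ℝ)..b, F s := fun b hb => by
    rw [hZ, hF]; exact hbal b ⟨hb.1.le, hb.2⟩
  have hZ0 : ∀ s ∈ Icc 0 T, 0 ≤ Z s := fun s _ => by
    rw [hZ]
    exact Finset.sum_nonneg fun i _ => integral_nonneg fun x => frobeniusNormSq_nonneg _
  -- (qualitative) sup bounds of the reference field, the difference and their derivatives
  obtain ⟨Bu, hBu⟩ := linfty_bound_of_hasBoundedSobolevNormsOn_holds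
    (fun s hs => (hu.contDiff_velocity hs).of_le (by norm_cast)) hU
  obtain ⟨B₁, -, hB₁⟩ := exists_forall_norm_fderiv_le_of_hasBoundedSobolevNormsOn
    (fun s hs => (hu.contDiff_velocity hs).of_le (by norm_cast)) hU
  have hwsm : IsSmoothSpaceTimeOn (Icc 0 T) (v - u) := hv.smooth_velocity.sub hu.smooth_velocity
  have hwsob : HasBoundedSobolevNormsOn (Icc 0 T) (v - u) :=
    agq_sobolev_sub (fun s _ x => rfl) (fun s hs => hv.contDiff_velocity hs)
      (fun s hs => hu.contDiff_velocity hs) hV hU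
  obtain ⟨Bw₁, -, hBw₁⟩ := exists_forall_norm_fderiv_le_of_hasBoundedSobolevNormsOn
    (fun s hs => (hwsm.contDiff_slice hs).of_le (by norm_cast)) hwsob
  obtain ⟨Bw₂, -, hBw₂'⟩ := exists_forall_norm_fderiv_fderiv_le_of_hasBoundedSobolevNormsOn
    (fun s hs => (hwsm.contDiff_slice hs).of_le (by norm_cast)) hwsob
  have hBw₂ : ∀ s ∈ Icc 0 T, ∀ x, ‖iteratedFDeriv ℝ 2 ((v - u) s) x‖ ≤ Bw₂ := fun s hs x => by
    rw [← norm_iteratedFDeriv_fderiv, ← norm_iteratedFDeriv_fderiv, norm_iteratedFDeriv_zero]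
    exact hBw₂' s hs x
  have hfsm : IsSmoothSpaceTimeOn (Icc 0 T) f := hu.isSmoothSpaceTimeOn_force hU'
  have hgsm : IsSmoothSpaceTimeOn (Icc 0 T) g := hv.isSmoothSpaceTimeOn_force hU'
  -- signs and continuity of the rates
  have hG0 : ∀ s ∈ Icc 0 T, 0 ≤ G s := fun s hs =>
    agq_compressionRate_nonneg (hu.divFree s hs) (hG s hs)
  have hσ₂0 : ∀ s ∈ Icc 0 T, 0 ≤ σ₂ s := fun s hs => (norm_nonneg _).trans (hσ₂ s hs 0)
  have hσ₃0 : ∀ s ∈ Icc 0 T, 0 ≤ σ₃ s := fun s hs => (norm_nonneg _).trans (hσ₃ s hs 0)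
  have hX₁0 : ∀ s ∈ Icc 0 T, 0 ≤ X₁ s := fun s hs =>
    (integral_nonneg fun x => frobeniusNormSq_nonneg _).trans (hX₁ s hs)
  have hH₁0 : ∀ s ∈ Icc 0 T, 0 ≤ H₁ s := fun s hs =>
    (integral_nonneg fun x => sq_nonneg _).trans (hH₁ s hs)
  have hl0 : ∀ s ∈ Icc 0 T, 0 ≤ 6 * G s + 9 * κ * σ₂ s + 3 * κ ^ 2 * σ₃ s +
      3 * A ^ 2 * X₁ s / (ν * μ) + 27 * A ^ 4 * X₁ s ^ 2 / (16 * ν ^ 3) :=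
    fun s hs => by
      have := hG0 s hs; have := hσ₂0 s hs; have := hσ₃0 s hs; have := hX₁0 s hs
      positivity
  have hψ0 : ∀ s ∈ Icc 0 T, 0 ≤ 27 * σ₂ s / κ * X₁ s + 9 * σ₃ s / κ ^ 2 * L s ^ 2 + 6 / ν * H₁ s :=
    fun s hs => by
      have := hσ₂0 s hs; have := hσ₃0 s hs; have := hX₁0 s hs; have := hH₁0 s hs
      positivity
  have hlc : ContinuousOn (fun s => 6 * G s + 9 * κ * σ₂ s + 3 * κ ^ 2 * σ₃ s +
      3 * A ^ 2 * X₁ s / (ν * μ) + 27 * A ^ 4 * X₁ s ^ 2 / (16 * ν ^ 3))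
      (Icc 0 T) :=
    ((((continuousOn_const.mul hGc).add (continuousOn_const.mul hσ₂c)).add
      (continuousOn_const.mul hσ₃c)).add
      ((continuousOn_const.mul hX₁c).div_const _)).add
      ((continuousOn_const.mul (hX₁c.pow 2)).div_const _)
  have hψc : ContinuousOn
      (fun s => 27 * σ₂ s / κ * X₁ s + 9 * σ₃ s / κ ^ 2 * L s ^ 2 + 6 / ν * H₁ s) (Icc 0 T) :=
    ((((continuousOn_const.mul hσ₂c).div_const _).mul hX₁c).add
      (((continuousOn_const.mul hσ₃c).div_const _).mul (hLc.pow 2))).add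
      (continuousOn_const.mul hH₁c)
  -- the slice bound along the two solutions, weakened to the majorants
  have hFle : ∀ s ∈ Icc 0 T, F s ≤
      (6 * G s + 9 * κ * σ₂ s + 3 * κ ^ 2 * σ₃ s + 3 * A ^ 2 * X₁ s / (ν * μ) +
          27 * A ^ 4 * X₁ s ^ 2 / (16 * ν ^ 3)) * Z s +
        A ^ 2 * μ / ν * Z s ^ (1 + 1) +
        (27 * σ₂ s / κ * X₁ s + 9 * σ₃ s / κ ^ 2 * L s ^ 2 + 6 / ν * H₁ s) := by
    intro s hs
    have hw : ContDiff ℝ ∞ ((v - u) s) := hwsm.contDiff_slice hs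
    have hft : ContDiff ℝ ∞ (f s) := hfsm.contDiff_slice hs
    have hgt : ContDiff ℝ ∞ (g s) := hgsm.contDiff_slice hs
    have hh : ContDiff ℝ 1 (fun y => f s y - g s y) := (hft.sub hgt).of_le (by norm_cast)
    have hh1 : ∫⁻ x, ‖fderiv ℝ (fun y => f s y - g s y) x‖ₑ ^ 2 < ⊤ := by
      have eD : ∀ x, fderiv ℝ (fun y => f s y - g s y) x = fderiv ℝ (f s) x - fderiv ℝ (g s) x :=
        fun x => fderiv_fun_sub ((hft.differentiable (by simp)) x) ((hgt.differentiable (by simp)) x)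
      refine lt_of_le_of_lt (le_of_eq (lintegral_congr fun x => by rw [eD x])) ?_
      exact agq_lintegral_sq_sub_lt_top
        (((hft.of_le (by norm_cast) : ContDiff ℝ 1 (f s)).continuous_fderiv
          one_ne_zero).aestronglyMeasurable) (hfD s hs) (hgD s hs)
    have key := robustness_flux_H2_le_strain_of_agmonBound hAg hν (hu.contDiff_velocity hs) hw hh
      (hu.divFree s hs) (fun n => agq_fin hs n (hwsob n)) hh1 (hBu s hs) (hB₁ s hs)
      (agq_fin hs 1 (hU 1)) (agq_fin hs 2 (hU 2)) (hBw₁ s hs) (hBw₂ s hs) (hG s hs)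
      (hσ₂ s hs) (hσ₃ s hs) (hL s hs) hκ
    have ev : (fun z => u s z + (v - u) s z) = v s := by
      funext z
      simp only [Pi.sub_apply]
      abel
    rw [ev] at key
    -- `∫‖Δw‖² ≤ 3Z`
    have hFr : ∀ i, Integrable (fun x => frobeniusNormSq
        (fderiv ℝ (fun y => fderiv ℝ ((v - u) s) y (e i)) x)) volume := fun i =>
      agq_integrable_frobeniusNormSq
        (((hw.fderiv_right (m := ∞) (by simp)).clm_apply contDiff_const).of_le (by norm_cast))
        (lintegral_enorm_sq_lt_top_of_norm_le
          (fun x => norm_iteratedFDeriv_fderiv_apply_basisFun_le hw 1 (by exact_mod_cast le_top) x i)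
          (agq_fin hs 2 (hwsob 2)))
    have hY := agq_integral_laplacian_sq_le_three_mul_sum hw hFr
    have hZs : Z s = ∑ i, ∫ x, frobeniusNormSq (fderiv ℝ (fun y => fderiv ℝ ((v - u) s) y (e i)) x) :=
      by rw [hZ]
    have hFs : F s = ∑ i,
        (-(2 * ν * ∫ x, ‖(Δ (fun y => fderiv ℝ ((v - u) s) y (e i))) x‖ ^ 2) +
          2 * (∫ x, ⟪fderiv ℝ (fun y => convect (v s) ((v - u) s) y + convect ((v - u) s) (u s) y) x
              (e i), (Δ (fun y => fderiv ℝ ((v - u) s) y (e i))) x⟫) +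
          2 * (∫ x, ⟪fderiv ℝ (fun y => f s y - g s y) x (e i),
            (Δ (fun y => fderiv ℝ ((v - u) s) y (e i))) x⟫)) := by rw [hF]
    rw [← hZs] at key hY
    rw [← hFs] at key
    have hXa0 : 0 ≤ ∫ x, frobeniusNormSq (fderiv ℝ ((v - u) s) x) :=
      integral_nonneg fun x => frobeniusNormSq_nonneg _
    have hY0 : 0 ≤ ∫ x, ‖(Δ ((v - u) s)) x‖ ^ 2 := integral_nonneg fun x => sq_nonneg _
    have hHa0 : 0 ≤ ∫ x, ‖fderiv ℝ (fun y => f s y - g s y) x‖ ^ 2 :=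
      integral_nonneg fun x => sq_nonneg _
    have hXa := hX₁ s hs
    have hHa := hH₁ s hs
    have hZ0s := hZ0 s hs
    have hG0s := hG0 s hs
    have hσ₂0s := hσ₂0 s hs
    have hσ₃0s := hσ₃0 s hs
    have hX0s := hX₁0 s hs
    generalize (∫ x, frobeniusNormSq (fderiv ℝ ((v - u) s) x)) = Xa at key hXa hXa0
    generalize (∫ x, ‖(Δ ((v - u) s)) x‖ ^ 2) = Y at key hY hY0
    generalize (∫ x, ‖fderiv ℝ (fun y => f s y - g s y) x‖ ^ 2) = H at key hHa hHa0
    generalize Z s = Zs at key hY hZ0s ⊢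
    generalize F s = Fs at key ⊢
    generalize G s = G' at key hG0s ⊢
    generalize σ₂ s = σ₂' at key hσ₂0s ⊢
    generalize σ₃ s = σ₃' at key hσ₃0s ⊢
    generalize X₁ s = Xb at hXa hX0s ⊢
    generalize H₁ s = Hb at hHa ⊢
    generalize L s = L' at key ⊢
    -- the weakening steps
    have hA2ν : 0 ≤ A ^ 2 / ν := by positivity
    have s1 : Real.sqrt (Xa * Y) ≤ Real.sqrt (3 * Xb * Zs) := by
      refine Real.sqrt_le_sqrt ?_
      have := mul_le_mul hXa hY hY0 hX0s
      linarith
    have s2 : 2 * Real.sqrt (3 * Xb * Zs) ≤ μ * Zs + 3 * Xb / μ := by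
      have h := agq_two_mul_le_kappa (L := Real.sqrt (3 * Xb)) (s := Real.sqrt Zs) hμ
      rw [Real.sq_sqrt hZ0s, Real.sq_sqrt (by positivity), mul_assoc,
        ← Real.sqrt_mul (by positivity)] at h
      linarith
    have s3 : 2 * A ^ 2 * Real.sqrt (Xa * Y) / ν * Zs ≤
        A ^ 2 * μ / ν * Zs ^ 2 + 3 * A ^ 2 * Xb / (ν * μ) * Zs := by
      have h1 : 2 * A ^ 2 * Real.sqrt (Xa * Y) / ν * Zs ≤
          2 * A ^ 2 * Real.sqrt (3 * Xb * Zs) / ν * Zs := by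
        have := mul_le_mul_of_nonneg_left s1 hA2ν
        have := mul_le_mul_of_nonneg_right this hZ0s
        have e1 : 2 * A ^ 2 * Real.sqrt (Xa * Y) / ν * Zs =
            2 * (A ^ 2 / ν * Real.sqrt (Xa * Y) * Zs) := by ring
        have e2 : 2 * A ^ 2 * Real.sqrt (3 * Xb * Zs) / ν * Zs =
            2 * (A ^ 2 / ν * Real.sqrt (3 * Xb * Zs) * Zs) := by ring
        rw [e1, e2]
        linarith
      have h2 : 2 * A ^ 2 * Real.sqrt (3 * Xb * Zs) / ν * Zs ≤
          A ^ 2 * μ / ν * Zs ^ 2 + 3 * A ^ 2 * Xb / (ν * μ) * Zs := by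
        have := mul_le_mul_of_nonneg_left s2 (mul_nonneg hA2ν hZ0s)
        have e1 : 2 * A ^ 2 * Real.sqrt (3 * Xb * Zs) / ν * Zs =
            A ^ 2 / ν * Zs * (2 * Real.sqrt (3 * Xb * Zs)) := by ring
        have e2 : A ^ 2 * μ / ν * Zs ^ 2 + 3 * A ^ 2 * Xb / (ν * μ) * Zs =
            A ^ 2 / ν * Zs * (μ * Zs + 3 * Xb / μ) := by
          ring
        rw [e1, e2]
        exact this
      exact h1.trans h2
    have s4 : 27 * A ^ 4 * Xa ^ 2 / (16 * ν ^ 3) * Zs ≤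
        27 * A ^ 4 * Xb ^ 2 / (16 * ν ^ 3) * Zs := by
      have := pow_le_pow_left₀ hXa0 hXa 2
      have h16 : 0 ≤ 27 * A ^ 4 / (16 * ν ^ 3) * Zs := by positivity
      have := mul_le_mul_of_nonneg_left this h16
      have e1 : 27 * A ^ 4 * Xa ^ 2 / (16 * ν ^ 3) * Zs =
          27 * A ^ 4 / (16 * ν ^ 3) * Zs * Xa ^ 2 := by ring
      have e2 : 27 * A ^ 4 * Xb ^ 2 / (16 * ν ^ 3) * Zs =
          27 * A ^ 4 / (16 * ν ^ 3) * Zs * Xb ^ 2 := by ring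
      rw [e1, e2]
      exact this
    have s5 : 27 * σ₂' / κ * Xa ≤ 27 * σ₂' / κ * Xb :=
      mul_le_mul_of_nonneg_left hXa (by positivity)
    have s6 : 6 / ν * H ≤ 6 / ν * Hb := mul_le_mul_of_nonneg_left hHa (by positivity)
    have hidL : (6 * G' + 9 * κ * σ₂' + 3 * κ ^ 2 * σ₃' + 2 * A ^ 2 * Real.sqrt (Xa * Y) / ν +
          27 * A ^ 4 * Xa ^ 2 / (16 * ν ^ 3)) * Zs =
        (6 * G' + 9 * κ * σ₂' + 3 * κ ^ 2 * σ₃') * Zs +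
          2 * A ^ 2 * Real.sqrt (Xa * Y) / ν * Zs +
          27 * A ^ 4 * Xa ^ 2 / (16 * ν ^ 3) * Zs := by ring
    have hidR : (6 * G' + 9 * κ * σ₂' + 3 * κ ^ 2 * σ₃' + 3 * A ^ 2 * Xb / (ν * μ) +
          27 * A ^ 4 * Xb ^ 2 / (16 * ν ^ 3)) * Zs =
        (6 * G' + 9 * κ * σ₂' + 3 * κ ^ 2 * σ₃') * Zs +
          3 * A ^ 2 * Xb / (ν * μ) * Zs +
          27 * A ^ 4 * Xb ^ 2 / (16 * ν ^ 3) * Zs := by ring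
    have hsq : Zs ^ (1 + 1) = Zs ^ 2 := by norm_num
    rw [hidL] at key
    rw [hidR, hsq]
    linarith [key, s3, s4, s5, s6]
  -- the comparison (Dashti–Robinson's Lemma 1, `n = 1`)
  have hsmall' : ((1 : ℕ) : ℝ) * (A ^ 2 * μ / ν * Real.exp (((1 : ℕ) : ℝ) * Λ T)) *
      (Z 0 + Φ T) ^ (1 : ℕ) * T < 1 := by
    rw [hZ]
    simpa using hsmall
  have H := Literature.Analysis.ODE.pow_le_of_integral_balance_le_linear_add_pow_succ_add
    (n := 1) one_pos hT (by positivity : (0 : ℝ) ≤ A ^ 2 * μ / ν) hZc' hFi' hbal' hFle hZ0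
    hlc hψc hl0 hψ0 hΛ hΛ0 hΦ hΦ0 hφ hsmall' ht
  simp only [pow_one, Nat.cast_one, one_mul] at H
  rw [hZ] at H
  exact H

end RobustnessH2

/-! ## §F The sup-norm readout of the `H¹` and `H²` distances (Agmon) -/

section SupReadout

variable {ν T : ℝ} {f g u v : ℝ → EuclideanSpace ℝ (Fin 3) → EuclideanSpace ℝ (Fin 3)}
variable {p q : ℝ → EuclideanSpace ℝ (Fin 3) → ℝ}

/-- **Sup-norm readout** (RRS 2016, Thm 1.20 = Agmon, in the quantities of the two robustness
theorems): for a `C^∞` field `w` on `ℝ³` with `w, Dw, D²w, D³w ∈ L²` and majorants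
`∫|∇w|²_F ≤ X₁`, `Σᵢ∫|∇∂ᵢw|²_F ≤ Z`: `‖w(x)‖ ≤ A(3X₁Z)^{1/4}` (`A` with `AgmonBoundR3 A`; Agmon
`‖w‖_∞ ≤ A(∫|∇w|²_F·∫‖Δw‖²)^{1/4}` and `∫‖Δw‖² ≤ 3Z`).
[cite: RobinsonRodrigoSadowskiCUP2016, Thm 1.20] -/
theorem norm_le_mul_rpow_of_le_of_agmonBound {A : ℝ} (hAg : AgmonBoundR3 A)
    {w : EuclideanSpace ℝ (Fin 3) → EuclideanSpace ℝ (Fin 3)} (hw : ContDiff ℝ ∞ w)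
    (hn : ∀ n : ℕ, ∫⁻ x, ‖iteratedFDeriv ℝ n w x‖ₑ ^ 2 < ⊤)
    {X₁ Z : ℝ} (hX₁ : ∫ x, frobeniusNormSq (fderiv ℝ w x) ≤ X₁)
    (hZ : (∑ i, ∫ x, frobeniusNormSq
      (fderiv ℝ (fun y => fderiv ℝ w y (EuclideanSpace.basisFun (Fin 3) ℝ i)) x)) ≤ Z)
    (x : EuclideanSpace ℝ (Fin 3)) :
    ‖w x‖ ≤ A * (3 * X₁ * Z) ^ (1 / 4 : ℝ) := by
  have hA := hAg.norm_le hw hn x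
  have hFr : ∀ i, Integrable (fun x => frobeniusNormSq
      (fderiv ℝ (fun y => fderiv ℝ w y (EuclideanSpace.basisFun (Fin 3) ℝ i)) x)) volume := fun i =>
    agq_integrable_frobeniusNormSq
      (((hw.fderiv_right (m := ∞) (by simp)).clm_apply contDiff_const).of_le (by norm_cast))
      (lintegral_enorm_sq_lt_top_of_norm_le
        (fun x => norm_iteratedFDeriv_fderiv_apply_basisFun_le hw 1 (by exact_mod_cast le_top) x i) (hn 2))
  have hY := agq_integral_laplacian_sq_le_three_mul_sum hw hFr
  have hX0 : 0 ≤ ∫ x, frobeniusNormSq (fderiv ℝ w x) := integral_nonneg fun x => frobeniusNormSq_nonneg _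
  have hY0 : 0 ≤ ∫ y, ‖(Δ w) y‖ ^ 2 := integral_nonneg fun x => sq_nonneg _
  have hprod : (∫ y, frobeniusNormSq (fderiv ℝ w y)) * (∫ y, ‖(Δ w) y‖ ^ 2) ≤ 3 * X₁ * Z := by
    have h1 := mul_le_mul hX₁ hY hY0 (hX0.trans hX₁)
    have h2 : X₁ * (3 * ∑ i, ∫ x, frobeniusNormSq
        (fderiv ℝ (fun y => fderiv ℝ w y (EuclideanSpace.basisFun (Fin 3) ℝ i)) x)) ≤
        X₁ * (3 * Z) := mul_le_mul_of_nonneg_left (by linarith) (hX0.trans hX₁)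
    linarith
  exact hA.trans (mul_le_mul_of_nonneg_left
    (Real.rpow_le_rpow (mul_nonneg hX0 hY0) hprod (by norm_num)) hAg.nonneg)

/-- **Sup-norm distance of two classical solutions from the `H¹` and `H²` certificates** (the
readout the strain-currency doors use): in the `L²`-Sobolev class, if at time `t ∈ [0, T]`
`∫|∇(v − u)(t)|²_F ≤ X₁` and `Σᵢ∫|∇∂ᵢ(v − u)(t)|²_F ≤ Z` (e.g. the bounds of
`classicalNS_robustness_strain_R3` and `classicalNS_robustness_H2_strain_R3`), then
`‖v(t,x) − u(t,x)‖ ≤ A(3X₁Z)^{1/4}` for every `x`. [cite: RobinsonRodrigoSadowskiCUP2016, Thm 1.20 and Thm 9.1] -/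
theorem classicalNS_norm_sub_le_of_H1_H2_of_agmonBound {A : ℝ} (hAg : AgmonBoundR3 A)
    (hv : IsClassicalNSSolutionOn (Icc 0 T) ν g v q) (hu : IsClassicalNSSolutionOn (Icc 0 T) ν f u p)
    (hU : HasBoundedSobolevNormsOn (Icc 0 T) u) (hV : HasBoundedSobolevNormsOn (Icc 0 T) v)
    {t : ℝ} (ht : t ∈ Icc 0 T) {X₁ Z : ℝ}
    (hX₁ : ∫ x, frobeniusNormSq (fderiv ℝ ((v - u) t) x) ≤ X₁)
    (hZ : (∑ i, ∫ x, frobeniusNormSq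
      (fderiv ℝ (fun y => fderiv ℝ ((v - u) t) y (EuclideanSpace.basisFun (Fin 3) ℝ i)) x)) ≤ Z)
    (x : EuclideanSpace ℝ (Fin 3)) :
    ‖v t x - u t x‖ ≤ A * (3 * X₁ * Z) ^ (1 / 4 : ℝ) := by
  have hwsm : IsSmoothSpaceTimeOn (Icc 0 T) (v - u) := hv.smooth_velocity.sub hu.smooth_velocity
  have hwsob : HasBoundedSobolevNormsOn (Icc 0 T) (v - u) :=
    agq_sobolev_sub (fun s _ x => rfl) (fun s hs => hv.contDiff_velocity hs)
      (fun s hs => hu.contDiff_velocity hs) hV hU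
  have h := norm_le_mul_rpow_of_le_of_agmonBound hAg (hwsm.contDiff_slice ht)
    (fun n => agq_fin ht n (hwsob n)) hX₁ hZ x
  simpa only [Pi.sub_apply] using h

end SupReadout

/-! ## §G Window-generic form with integral envelopes (the shape a windowed certificate checks) -/

section WindowH2

variable {ν t₀ t₁ : ℝ} {f g u v : ℝ → EuclideanSpace ℝ (Fin 3) → EuclideanSpace ℝ (Fin 3)}
variable {p q : ℝ → EuclideanSpace ℝ (Fin 3) → ℝ}

/-- **Robustness of regularity at the `H²` level in strain form on an arbitrary window
`[t₀, t₁]`, with the accumulated envelopes written as integrals (Dashti–Robinson 2008, Thm 2's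
estimate in the currency `(G, σ₂, σ₃)`), a priori, explicit.** In the setting of
`classicalNS_robustness_H2_strain_R3` transported to `[t₀, t₁]` (`t₀ < t₁`), with a continuous
majorant `ψ ≥ 27σ₂X₁/κ + 9σ₃L²/κ² + 6H₁/ν` of the source, rate
`l = 6G + 9κσ₂ + 3κ²σ₃ + 3A²X₁/(νμ) + 27A⁴X₁²/(16ν³)`, `β = A²μ/ν`,
`η = Z(t₀) + ∫_{t₀}^{t₁} ψ`: if `βe^{∫_{t₀}^{t₁} l}η(t₁ − t₀) < 1` then for `t ∈ [t₀, t₁]`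
`Z(t) ≤ e^{∫_{t₀}^{t} l}η/(1 − βe^{∫_{t₀}^{t₁} l}η(t − t₀))`
(`classicalNS_robustness_H2_strain_R3` after the time translation
`IsClassicalNSSolutionOn.comp_add_right`, with `Φ = ∫ψ ≥ ∫e^{−Λ}ψ`).
[cite: DashtiRobinson2008, Thm 2 (proof) and Lemma 1] -/
theorem classicalNS_robustness_H2_strain_window_of_agmonBound {A : ℝ} (hAg : AgmonBoundR3 A) (hν : 0 < ν) (ht₀₁ : t₀ < t₁)
    (hv : IsClassicalNSSolutionOn (Icc t₀ t₁) ν g v q)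
    (hu : IsClassicalNSSolutionOn (Icc t₀ t₁) ν f u p)
    (hU : HasBoundedSobolevNormsOn (Icc t₀ t₁) u)
    (hUt : HasBoundedSobolevNormsOn (Icc t₀ t₁) (timeDerivWithin (Icc t₀ t₁) u))
    (hp : ∀ n : ℕ, ∃ C : ℝ≥0, ∀ t ∈ Icc t₀ t₁, ∫⁻ x, ‖iteratedFDeriv ℝ n (p t) x‖ₑ ^ 2 ≤ C)
    (hV : HasBoundedSobolevNormsOn (Icc t₀ t₁) v)
    (hVt : HasBoundedSobolevNormsOn (Icc t₀ t₁) (timeDerivWithin (Icc t₀ t₁) v))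
    (hq : ∀ n : ℕ, ∃ C : ℝ≥0, ∀ t ∈ Icc t₀ t₁, ∫⁻ x, ‖iteratedFDeriv ℝ n (q t) x‖ₑ ^ 2 ≤ C)
    (hfD : ∀ t ∈ Icc t₀ t₁, ∫⁻ x, ‖fderiv ℝ (f t) x‖ₑ ^ 2 < ⊤)
    (hgD : ∀ t ∈ Icc t₀ t₁, ∫⁻ x, ‖fderiv ℝ (g t) x‖ₑ ^ 2 < ⊤)
    {G σ₂ σ₃ L X₁ H₁ ψ : ℝ → ℝ} {κ μ : ℝ} (hκ : 0 < κ) (hμ : 0 < μ)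
    (hG : ∀ s ∈ Icc t₀ t₁, ∀ (x ξ : EuclideanSpace ℝ (Fin 3)),
      -⟪fderiv ℝ (u s) x ξ, ξ⟫ ≤ G s * ‖ξ‖ ^ 2)
    (hσ₂ : ∀ s ∈ Icc t₀ t₁, ∀ x, ‖iteratedFDeriv ℝ 2 (u s) x‖ ≤ σ₂ s)
    (hσ₃ : ∀ s ∈ Icc t₀ t₁, ∀ x, ‖iteratedFDeriv ℝ 3 (u s) x‖ ≤ σ₃ s)
    (hL : ∀ s ∈ Icc t₀ t₁, Real.sqrt (∫ x, ‖(v - u) s x‖ ^ 2) ≤ L s)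
    (hX₁ : ∀ s ∈ Icc t₀ t₁, ∫ x, frobeniusNormSq (fderiv ℝ ((v - u) s) x) ≤ X₁ s)
    (hH₁ : ∀ s ∈ Icc t₀ t₁, ∫ x, ‖fderiv ℝ (fun y => f s y - g s y) x‖ ^ 2 ≤ H₁ s)
    (hψ : ∀ s ∈ Icc t₀ t₁,
      27 * σ₂ s / κ * X₁ s + 9 * σ₃ s / κ ^ 2 * L s ^ 2 + 6 / ν * H₁ s ≤ ψ s)
    (hGc : ContinuousOn G (Icc t₀ t₁)) (hσ₂c : ContinuousOn σ₂ (Icc t₀ t₁))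
    (hσ₃c : ContinuousOn σ₃ (Icc t₀ t₁)) (hLc : ContinuousOn L (Icc t₀ t₁))
    (hX₁c : ContinuousOn X₁ (Icc t₀ t₁)) (hH₁c : ContinuousOn H₁ (Icc t₀ t₁))
    (hψc : ContinuousOn ψ (Icc t₀ t₁))
    (hsmall : A ^ 2 * μ / ν *
        Real.exp (∫ s in t₀..t₁, (6 * G s + 9 * κ * σ₂ s + 3 * κ ^ 2 * σ₃ s +
          3 * A ^ 2 * X₁ s / (ν * μ) + 27 * A ^ 4 * X₁ s ^ 2 / (16 * ν ^ 3))) *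
      ((∑ i, ∫ x, frobeniusNormSq (fderiv ℝ (fun y => fderiv ℝ ((v - u) t₀) y
        (EuclideanSpace.basisFun (Fin 3) ℝ i)) x)) + ∫ s in t₀..t₁, ψ s) * (t₁ - t₀) < 1)
    {t : ℝ} (ht : t ∈ Icc t₀ t₁) :
    (∑ i, ∫ x, frobeniusNormSq (fderiv ℝ (fun y => fderiv ℝ ((v - u) t) y
        (EuclideanSpace.basisFun (Fin 3) ℝ i)) x)) ≤
      Real.exp (∫ s in t₀..t, (6 * G s + 9 * κ * σ₂ s + 3 * κ ^ 2 * σ₃ s +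
          3 * A ^ 2 * X₁ s / (ν * μ) + 27 * A ^ 4 * X₁ s ^ 2 / (16 * ν ^ 3))) *
          ((∑ i, ∫ x, frobeniusNormSq (fderiv ℝ (fun y => fderiv ℝ ((v - u) t₀) y
            (EuclideanSpace.basisFun (Fin 3) ℝ i)) x)) + ∫ s in t₀..t₁, ψ s) /
        (1 - A ^ 2 * μ / ν *
          Real.exp (∫ s in t₀..t₁, (6 * G s + 9 * κ * σ₂ s + 3 * κ ^ 2 * σ₃ s +
            3 * A ^ 2 * X₁ s / (ν * μ) + 27 * A ^ 4 * X₁ s ^ 2 / (16 * ν ^ 3))) *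
          ((∑ i, ∫ x, frobeniusNormSq (fderiv ℝ (fun y => fderiv ℝ ((v - u) t₀) y
            (EuclideanSpace.basisFun (Fin 3) ℝ i)) x)) + ∫ s in t₀..t₁, ψ s) * (t - t₀)) := by
  have hT : 0 < t₁ - t₀ := sub_pos.2 ht₀₁
  -- the rate as one function
  obtain ⟨l, hl⟩ : ∃ l : ℝ → ℝ, l = fun s => 6 * G s + 9 * κ * σ₂ s + 3 * κ ^ 2 * σ₃ s +
      3 * A ^ 2 * X₁ s / (ν * μ) + 27 * A ^ 4 * X₁ s ^ 2 / (16 * ν ^ 3) :=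
    ⟨_, rfl⟩
  have hl' : ∀ s, 6 * G s + 9 * κ * σ₂ s + 3 * κ ^ 2 * σ₃ s +
      3 * A ^ 2 * X₁ s / (ν * μ) + 27 * A ^ 4 * X₁ s ^ 2 / (16 * ν ^ 3) = l s :=
    fun s => by rw [hl]
  simp only [hl'] at hsmall ⊢
  -- the translated window `[0, t₁ − t₀]`
  have hpre : (fun s => s + t₀) ⁻¹' Icc t₀ t₁ = Icc 0 (t₁ - t₀) := by
    rw [Set.preimage_add_const_Icc, sub_self]
  have hmem : ∀ {s}, s ∈ Icc 0 (t₁ - t₀) → s + t₀ ∈ Icc t₀ t₁ := fun hs =>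
    ⟨by linarith [hs.1], by linarith [hs.2]⟩
  have hmaps : MapsTo (fun s => s + t₀) (Icc 0 (t₁ - t₀)) (Icc t₀ t₁) := fun s hs => hmem hs
  have hu' : IsClassicalNSSolutionOn (Icc 0 (t₁ - t₀)) ν (fun s => f (s + t₀)) (fun s => u (s + t₀))
      (fun s => p (s + t₀)) := by
    have h := hu.comp_add_right t₀
    rwa [hpre] at h
  have hv' : IsClassicalNSSolutionOn (Icc 0 (t₁ - t₀)) ν (fun s => g (s + t₀)) (fun s => v (s + t₀))
      (fun s => q (s + t₀)) := by
    have h := hv.comp_add_right t₀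
    rwa [hpre] at h
  have hIcc : Icc t₀ t₁ = Icc (0 + t₀) (t₁ - t₀ + t₀) := by rw [zero_add, sub_add_cancel]
  have hU' : HasBoundedSobolevNormsOn (Icc 0 (t₁ - t₀)) (fun s => u (s + t₀)) := by
    rw [hIcc] at hU
    exact agq_bounds_comp_add hU
  have hV' : HasBoundedSobolevNormsOn (Icc 0 (t₁ - t₀)) (fun s => v (s + t₀)) := by
    rw [hIcc] at hV
    exact agq_bounds_comp_add hV
  have hWeq : ∀ (w : ℝ → EuclideanSpace ℝ (Fin 3) → EuclideanSpace ℝ (Fin 3)),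
      timeDerivWithin (Icc 0 (t₁ - t₀)) (fun s => w (s + t₀)) =
        fun s => timeDerivWithin (Icc t₀ t₁) w (s + t₀) := by
    intro w
    funext s x
    rw [← hpre]
    exact timeDerivWithin_comp_add_right (Icc t₀ t₁) w t₀ s x
  have hUt' : HasBoundedSobolevNormsOn (Icc 0 (t₁ - t₀))
      (timeDerivWithin (Icc 0 (t₁ - t₀)) (fun s => u (s + t₀))) := by
    rw [hWeq u]
    have h2 : ∀ n : ℕ, ∃ C : ℝ≥0, ∀ s ∈ Icc (0 + t₀) (t₁ - t₀ + t₀),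
        ∫⁻ x, ‖iteratedFDeriv ℝ n (timeDerivWithin (Icc t₀ t₁) u s) x‖ₑ ^ 2 ≤ C := by
      rw [← hIcc]; exact hUt
    exact agq_bounds_comp_add h2
  have hVt' : HasBoundedSobolevNormsOn (Icc 0 (t₁ - t₀))
      (timeDerivWithin (Icc 0 (t₁ - t₀)) (fun s => v (s + t₀))) := by
    rw [hWeq v]
    have h2 : ∀ n : ℕ, ∃ C : ℝ≥0, ∀ s ∈ Icc (0 + t₀) (t₁ - t₀ + t₀),
        ∫⁻ x, ‖iteratedFDeriv ℝ n (timeDerivWithin (Icc t₀ t₁) v s) x‖ₑ ^ 2 ≤ C := by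
      rw [← hIcc]; exact hVt
    exact agq_bounds_comp_add h2
  have hp' : ∀ n : ℕ, ∃ C : ℝ≥0, ∀ s ∈ Icc 0 (t₁ - t₀),
      ∫⁻ x, ‖iteratedFDeriv ℝ n (p (s + t₀)) x‖ₑ ^ 2 ≤ C := by
    rw [hIcc] at hp
    exact agq_bounds_comp_add hp
  have hq' : ∀ n : ℕ, ∃ C : ℝ≥0, ∀ s ∈ Icc 0 (t₁ - t₀),
      ∫⁻ x, ‖iteratedFDeriv ℝ n (q (s + t₀)) x‖ₑ ^ 2 ≤ C := by
    rw [hIcc] at hq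
    exact agq_bounds_comp_add hq
  have hfD' : ∀ s ∈ Icc 0 (t₁ - t₀), ∫⁻ x, ‖fderiv ℝ ((fun s => f (s + t₀)) s) x‖ₑ ^ 2 < ⊤ :=
    fun s hs => hfD (s + t₀) (hmem hs)
  have hgD' : ∀ s ∈ Icc 0 (t₁ - t₀), ∫⁻ x, ‖fderiv ℝ ((fun s => g (s + t₀)) s) x‖ₑ ^ 2 < ⊤ :=
    fun s hs => hgD (s + t₀) (hmem hs)
  -- the translated majorants and envelopes
  have cadd : Continuous fun s : ℝ => s + t₀ := continuous_id.add continuous_const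
  have hlcW : ContinuousOn l (Icc t₀ t₁) := by
    rw [hl]
    exact ((((continuousOn_const.mul hGc).add (continuousOn_const.mul hσ₂c)).add
      (continuousOn_const.mul hσ₃c)).add
      ((continuousOn_const.mul hX₁c).div_const _)).add
      ((continuousOn_const.mul (hX₁c.pow 2)).div_const _)
  have hlc : ContinuousOn (fun s => l (s + t₀)) (Icc 0 (t₁ - t₀)) := hlcW.comp cadd.continuousOn hmaps
  have hψc' : ContinuousOn (fun s => ψ (s + t₀)) (Icc 0 (t₁ - t₀)) :=
    hψc.comp cadd.continuousOn hmaps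
  have hG0 : ∀ s ∈ Icc t₀ t₁, 0 ≤ G s := fun s hs =>
    agq_compressionRate_nonneg (hu.divFree s hs) (hG s hs)
  have hσ₂0 : ∀ s ∈ Icc t₀ t₁, 0 ≤ σ₂ s := fun s hs => (norm_nonneg _).trans (hσ₂ s hs 0)
  have hσ₃0 : ∀ s ∈ Icc t₀ t₁, 0 ≤ σ₃ s := fun s hs => (norm_nonneg _).trans (hσ₃ s hs 0)
  have hX₁0 : ∀ s ∈ Icc t₀ t₁, 0 ≤ X₁ s := fun s hs =>
    (integral_nonneg fun x => frobeniusNormSq_nonneg _).trans (hX₁ s hs)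
  have hH₁0 : ∀ s ∈ Icc t₀ t₁, 0 ≤ H₁ s := fun s hs =>
    (integral_nonneg fun x => sq_nonneg _).trans (hH₁ s hs)
  have hl0 : ∀ s ∈ Icc t₀ t₁, 0 ≤ l s := fun s hs => by
    rw [hl]
    have := hG0 s hs; have := hσ₂0 s hs; have := hσ₃0 s hs; have := hX₁0 s hs
    positivity
  have hsrc0 : ∀ s ∈ Icc t₀ t₁,
      0 ≤ 27 * σ₂ s / κ * X₁ s + 9 * σ₃ s / κ ^ 2 * L s ^ 2 + 6 / ν * H₁ s := fun s hs => by
    have := hσ₂0 s hs; have := hσ₃0 s hs; have := hX₁0 s hs; have := hH₁0 s hs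
    positivity
  have hΛ : ∀ s ∈ Icc 0 (t₁ - t₀),
      HasDerivWithinAt (fun r => ∫ x in (0 : ℝ)..r, l (x + t₀)) (l (s + t₀)) (Icc 0 (t₁ - t₀)) s :=
    fun s hs => agq_hasDerivWithinAt_intervalIntegral hlc hs
  have hΦ : ∀ s ∈ Icc 0 (t₁ - t₀),
      HasDerivWithinAt (fun r => ∫ x in (0 : ℝ)..r, ψ (x + t₀)) (ψ (s + t₀)) (Icc 0 (t₁ - t₀)) s :=
    fun s hs => agq_hasDerivWithinAt_intervalIntegral hψc' hs
  have hΛnn : ∀ s ∈ Icc 0 (t₁ - t₀), 0 ≤ ∫ x in (0 : ℝ)..s, l (x + t₀) := fun s hs =>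
    intervalIntegral.integral_nonneg hs.1 fun x hx => hl0 (x + t₀) (hmem ⟨hx.1, hx.2.trans hs.2⟩)
  have hφ : ∀ s ∈ Icc 0 (t₁ - t₀),
      Real.exp (-(fun r => ∫ x in (0 : ℝ)..r, l (x + t₀)) s) *
        (27 * σ₂ (s + t₀) / κ * X₁ (s + t₀) + 9 * σ₃ (s + t₀) / κ ^ 2 * L (s + t₀) ^ 2 +
          6 / ν * H₁ (s + t₀)) ≤ ψ (s + t₀) := fun s hs =>
    (mul_le_of_le_one_left (hsrc0 (s + t₀) (hmem hs))
      (Real.exp_le_one_iff.2 (neg_nonpos.2 (hΛnn s hs)))).trans (hψ (s + t₀) (hmem hs))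
  -- change of variables in the envelopes
  have eΛ : ∀ r, (∫ x in (0 : ℝ)..r, l (x + t₀)) = ∫ s in t₀..(r + t₀), l s := fun r => by
    rw [intervalIntegral.integral_comp_add_right l, zero_add]
  have eΦ : ∀ r, (∫ x in (0 : ℝ)..r, ψ (x + t₀)) = ∫ s in t₀..(r + t₀), ψ s := fun r => by
    rw [intervalIntegral.integral_comp_add_right ψ, zero_add]
  -- the translated slices at `t − t₀` and `0`
  have hr : t - t₀ ∈ Icc 0 (t₁ - t₀) := ⟨sub_nonneg.2 ht.1, sub_le_sub_right ht.2 _⟩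
  have e1 : ((fun s => v (s + t₀)) - fun s => u (s + t₀)) (t - t₀) = (v - u) t := by
    funext x
    simp only [Pi.sub_apply, sub_add_cancel]
  have e0 : ((fun s => v (s + t₀)) - fun s => u (s + t₀)) 0 = (v - u) t₀ := by
    funext x
    simp only [Pi.sub_apply, zero_add]
  have hΛ' : ∀ s ∈ Icc 0 (t₁ - t₀),
      HasDerivWithinAt (fun r => ∫ x in (0 : ℝ)..r, l (x + t₀))
        (6 * G (s + t₀) + 9 * κ * σ₂ (s + t₀) + 3 * κ ^ 2 * σ₃ (s + t₀) +
          3 * A ^ 2 * X₁ (s + t₀) / (ν * μ) +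
          27 * A ^ 4 * X₁ (s + t₀) ^ 2 / (16 * ν ^ 3)) (Icc 0 (t₁ - t₀)) s := fun s hs => by
    rw [hl']; exact hΛ s hs
  have key := classicalNS_robustness_H2_strain_of_agmonBound hAg hν hT hv' hu' hU' hUt' hp' hV' hVt' hq' hfD' hgD'
    (G := fun s => G (s + t₀)) (σ₂ := fun s => σ₂ (s + t₀)) (σ₃ := fun s => σ₃ (s + t₀))
    (L := fun s => L (s + t₀)) (X₁ := fun s => X₁ (s + t₀)) (H₁ := fun s => H₁ (s + t₀))
    (Λ := fun r => ∫ x in (0 : ℝ)..r, l (x + t₀))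
    (Φ := fun r => ∫ x in (0 : ℝ)..r, ψ (x + t₀)) (φ := fun s => ψ (s + t₀)) hκ hμ
    (fun s hs => hG (s + t₀) (hmem hs)) (fun s hs => hσ₂ (s + t₀) (hmem hs))
    (fun s hs => hσ₃ (s + t₀) (hmem hs)) (fun s hs => hL (s + t₀) (hmem hs))
    (fun s hs => hX₁ (s + t₀) (hmem hs)) (fun s hs => hH₁ (s + t₀) (hmem hs))
    (hGc.comp cadd.continuousOn hmaps) (hσ₂c.comp cadd.continuousOn hmaps)
    (hσ₃c.comp cadd.continuousOn hmaps) (hLc.comp cadd.continuousOn hmaps)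
    (hX₁c.comp cadd.continuousOn hmaps) (hH₁c.comp cadd.continuousOn hmaps) hΛ'
    (by simp only [intervalIntegral.integral_same]) hΦ
    (by simp only [intervalIntegral.integral_same]) hφ ?_ hr
  · -- unpack the translated conclusion
    rw [e1, e0] at key
    simp only [eΛ, eΦ, sub_add_cancel] at key
    exact key
  · rw [e0]
    simp only [eΛ, eΦ, sub_add_cancel]
    exact hsmall

end WindowH2

end Literature.Analysis.FluidPDE
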